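import Summits.QuantumAdvantage.QuantumAdvantage.Theorems.SosSandwichTransferPBKeyedUniform
import Literature.Computability.Cryptography.ExplicitKWiseHashMachine
import Literature.Computability.Complexity.CanonicalCodes
import HarnessLib

/-!
# Crux `TransferPB` (stmt-QuantumAdvantage-15238, route SosSandwich), line `birth` — the keyed language of the node tests is in `P`

Obligation (Q) of the last stub `stub_pbOracleSimulation` (`nodeProblem F r c k ∈ PromiseBQP`). The quantum estimator
of the node tests is the keyed-oracle family run relative to ONE oracle language `A' = keyedLang F`
(`Theorems/SosSandwichTransferPBKeyedLanguage.lean`: `w ∈ A'` iff `w = ⟨⟨x, ⟨encPath ρ, t⟩⟩, ⟨pad, key ++ u⟩⟩` with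
`u` in the oracle whose relevant bits are the hash `stdFamily (2T) (n + anc) key` overridden along the path `ρ`). To
remove the oracle gates (`OracleRemovalKernel.lean`, `P ⊆ BQP`) one needs `A' ∈ P`. This file proves it, for a
uniform `F`:

* `pathItem`, `encPath_eq_encList` — the path code is the nested-pair list of the items `b σ(s)`; `pathItems n P`
  (`n` rounds of unpairing, `NegCNF.decList id`), `pathItems_encList`;
* `foldr_update_apply` — the value of an iterated override at a point: the FIRST matching entry, else the base;
  `answerBit k items keyL u` — the first item whose tail is `u` answers, else the hash bit `hashLangDecide ⟨⟨1ᵏ, keyL⟩, u⟩`;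
  **`mem_oracleOf_hashedPt_iff`** — `u ∈ oracleOf F x (hashedPt F x ρ key) ↔ answerBit (2T) (items of ρ) key u`;
* **`keyedLangDecide F`** — the Boolean decision function (parse the four fields, re-encode and compare, cut the key
  off the query, search the item count `n ≤ |P|` with `P = encList (pathItems n P)` and valid items, answer bit);
  **`keyedLangDecide_eq_true_iff`** — it decides `keyedLang F` (`exists_path_of_items` rebuilds `ρ` from valid items);
* `pathItemsC` (`CanonCode.canonListFn id` on `⟨1ⁿ, P⟩`), **`keyedLangDecideC`** — for uniform `F` the decision
  function is computed on codes (`codeFP_kOf_un`, `codeFP_mOf_un`, `codeFP_keyWidth`, `hashLangDecideC`, the `CodeFP`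
  algebra: `any`, `all`, `filter`, `ite`); **`keyedLang_mem_P`** — `keyedLang F ∈ P`.

All proved; no named fact. Sources: M. Zhandry, CRYPTO 2012, Thm. 3.1 (the keyed oracles); S. Aaronson,
A. Ambainis, Theory Comput. 10 (2014), proof of Thm. 23 (p. 14); S. Arora, B. Barak, Computational Complexity
(CUP 2009), §1.3 (polynomial-time string manipulation), §0.1 (codes of tuples).
-/

-- D-0017: single-conjunct summit ⇒ the duplicate `QuantumAdvantage.QuantumAdvantage` is mandated.
set_option linter.dupNamespace false

noncomputable section

namespace Summit.QuantumAdvantage.QuantumAdvantage.Cruxes.TransferPB.Birth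

open Finset Literature.Computability.Cryptography Literature.Computability.Complexity
  Literature.Computability.Complexity.Brick Literature.Computability.Complexity.Plumb
  Literature.Computability.QuantumComplexity Literature.Computability.QuantumComplexity.ClassicalSimulation
  Literature.Computability.Cryptography.ExplicitKWiseHash
open _root_.Computability CodeFP

namespace SimTreePB

variable (F : QCircuitFamily cliffordT)

/-! ### Items of a path code -/

/-- The item of the path entry `(s, b)`: the string `b σ(s)` (revealed bit, then the oracle string).
[cite: AaronsonAmbainis2014, Thm. 23 (proof, p. 14)] -/
def pathItem (x : List Bool) (e : Fin (numOracleBits F x) × Bool) : List Bool := e.2 :: bitString F x e.1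

/-- **The path code is the nested-pair list of its items.** [cite: AroraBarak2009, §0.1] -/
theorem encPath_eq_encList (x : List Bool) (ρ : List (Fin (numOracleBits F x) × Bool)) :
    encPath F x ρ = encList (ρ.map (pathItem F x)) := by
  induction ρ with
  | nil => rfl
  | cons e ρ ih => rw [encPath, List.map_cons, encList_cons, ih]; rfl

/-- An item is its revealed bit followed by a string shorter than the width. [folklore] -/
theorem length_pathItem (x : List Bool) (e : Fin (numOracleBits F x) × Bool) :
    1 ≤ (pathItem F x e).length ∧ (pathItem F x e).length ≤ oracleWidth F x := by
  have h := mem_shortStrings.1 ((bitEquiv F x).symm e.1).2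
  simp only [pathItem, List.length_cons, bitString]
  omega

/-- The items read off a string by `n` rounds of unpairing. [cite: AroraBarak2009, §0.1] -/
def pathItems (n : ℕ) (P : List Bool) : List (List Bool) := NegCNF.decList id n P

/-- Reading back a nested-pair list. [cite: AroraBarak2009, §0.1] -/
theorem pathItems_encList (l : List (List Bool)) : pathItems l.length (encList l) = l := by
  induction l with
  | nil => rfl
  | cons a l ih =>
    have ih' : NegCNF.decList id l.length (encList l) = l := ih
    simp only [pathItems, List.length_cons, NegCNF.decList, encList_cons, boolUnpair_boolPair, id, ih']

/-! ### The value of an iterated override -/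

/-- **The value of an iterated override at a point**: the bit of the FIRST entry at that point, else the base value.
[folklore] -/
theorem foldr_update_apply {ι : Type*} [DecidableEq ι] (ρ : List (ι × Bool)) (base : ι → Bool) (i : ι) (d : ι × Bool) :
    ρ.foldr (fun ib z => Function.update z ib.1 ib.2) base i =
      if (ρ.filter fun ib => decide (ib.1 = i)).isEmpty then base i
      else ((ρ.filter fun ib => decide (ib.1 = i)).headD d).2 := by
  induction ρ with
  | nil => simp
  | cons e ρ ih =>
    rw [List.foldr_cons]
    by_cases h : e.1 = i
    · subst h
      rw [List.filter_cons_of_pos (by simp), Function.update_self]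
      simp
    · have h' : i ≠ e.1 := fun h'' => h h''.symm
      rw [List.filter_cons_of_neg (by simp [h]), Function.update_of_ne h']
      exact ih

/-- **The answer bit**: the first item whose tail is `u` answers with its head bit; if there is none, the hash bit
`hashLangDecide ⟨⟨1ᵏ, keyL⟩, u⟩`. [cite: Zhandry2012IBE, Thm. 3.1] [cite: AaronsonAmbainis2014, Thm. 23 (proof, p. 14)] -/
def answerBit (k : ℕ) (items : List (List Bool)) (keyL u : List Bool) : Bool :=
  if (items.filter fun it => decide (it.drop 1 = u)).isEmpty then
    hashLangDecide (boolPair (boolPair (List.replicate k true) keyL) u)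
  else ((items.filter fun it => decide (it.drop 1 = u)).headD []).getD 0 false

variable {F} in
/-- **Membership in the overridden hash is the answer bit** of the items of the path.
[cite: Zhandry2012IBE, Thm. 3.1] [cite: WegmanCarter1981, §3] -/
theorem mem_oracleOf_hashedPt_iff (x : List Bool) (ρ : List (Fin (numOracleBits F x) × Bool))
    (key : Fin (keyPoly.eval (kOf F x.length + mOf F x.length)) → Bool) {u : List Bool}
    (hu : u.length < oracleWidth F x) :
    u ∈ oracleOf F x (hashedPt F x ρ key) ↔
      answerBit (kOf F x.length) (ρ.map (pathItem F x)) (List.ofFn key) u = true := by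
  classical
  set s : Fin (numOracleBits F x) := bitEquiv F x ⟨u, mem_shortStrings.2 hu⟩ with hs
  have hsymm : (bitEquiv F x).symm s = ⟨u, mem_shortStrings.2 hu⟩ := by
    rw [hs, Equiv.symm_apply_apply]
  -- membership is the value of the relevant bit `s`
  have hmem : u ∈ oracleOf F x (hashedPt F x ρ key) ↔ hashedPt F x ρ key s = true := by
    constructor
    · rintro ⟨h, hb⟩; exact hb
    · intro hb; exact ⟨mem_shortStrings.2 hu, hb⟩
  rw [hmem]
  -- the filters correspond
  have hfilt : (ρ.map (pathItem F x)).filter (fun it => decide (it.drop 1 = u)) =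
      (ρ.filter fun e => decide (e.1 = s)).map (pathItem F x) := by
    rw [List.filter_map]
    congr 1
    refine List.filter_congr fun e _ => ?_
    simp only [Function.comp_apply, pathItem, List.drop_succ_cons, List.drop_zero, bitString]
    by_cases h : e.1 = s
    · rw [decide_eq_true h]
      exact decide_eq_true (by rw [h, hsymm])
    · rw [decide_eq_false h]
      refine decide_eq_false fun h' => h ?_
      have h3 : (bitEquiv F x).symm e.1 = ⟨u, mem_shortStrings.2 hu⟩ := Subtype.ext h'
      rw [hs, ← h3, Equiv.apply_symm_apply]
  have hval := foldr_update_apply ρ (oracleBits F x (stdFamily (kOf F x.length) (mOf F x.length) key)) s (s, false)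
  unfold hashedPt
  rw [hval, answerBit, hfilt]
  cases hρ : ρ.filter (fun e => decide (e.1 = s)) with
  | nil =>
    simp only [List.map_nil, List.isEmpty_nil, if_true]
    rw [hashLangDecide_eq, mem_hashLang_iff, oracleBits, restrictBool_apply, hsymm]
  | cons e l =>
    simp only [List.map_cons, List.isEmpty_cons, List.headD_cons, pathItem]
    simp

/-! ### Rebuilding a path from valid items -/

variable {F} in
/-- **Valid items are the items of a path.** [cite: AroraBarak2009, §0.1] -/
theorem exists_path_of_items (x : List Bool) : ∀ items : List (List Bool),
    (∀ it ∈ items, 1 ≤ it.length ∧ it.length ≤ oracleWidth F x) →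
      ∃ ρ : List (Fin (numOracleBits F x) × Bool), ρ.map (pathItem F x) = items
  | [], _ => ⟨[], rfl⟩
  | it :: items, h => by
    obtain ⟨ρ, hρ⟩ := exists_path_of_items x items fun i hi => h i (List.mem_cons_of_mem _ hi)
    have hit := h it List.mem_cons_self
    have hlt : (it.drop 1).length < oracleWidth F x := by rw [List.length_drop]; omega
    refine ⟨(bitEquiv F x ⟨it.drop 1, mem_shortStrings.2 hlt⟩, it.getD 0 false) :: ρ, ?_⟩
    rw [List.map_cons, hρ]
    congr 1
    simp only [pathItem, bitString, Equiv.symm_apply_apply]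
    cases it with
    | nil => simp at hit
    | cons b l => rfl

/-! ### The decision function -/

/-- **The decision function of the keyed language.** Parse `w = ⟨⟨x, ⟨P, t⟩⟩, ⟨pad, rest⟩⟩` (re-encode and compare),
cut `rest = keyL ++ u` at the key width `κ = keyPoly (2T(|x|) + |x| + anc(|x|))`, require `|u| <` the width, find
the item count `n ≤ |P|` with `P = encList (pathItems n P)` and every item of length in `[1, width]`, and return the
answer bit. [cite: Zhandry2012IBE, Thm. 3.1] [cite: AroraBarak2009, §1.3] -/
def keyedLangDecide (w : List Bool) : Bool :=
  let a := (boolUnpair w).1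
  let b := (boolUnpair w).2
  let x := (boolUnpair a).1
  let c := (boolUnpair a).2
  let P := (boolUnpair c).1
  let t := (boolUnpair c).2
  let pad := (boolUnpair b).1
  let rest := (boolUnpair b).2
  let W := mOf F x.length
  let κ := keyPoly.eval (kOf F x.length + mOf F x.length)
  let keyL := rest.take κ
  let u := rest.drop κ
  decide (w = boolPair (boolPair x (boolPair P t)) (boolPair pad rest)) && decide (κ ≤ rest.length) &&
    decide (u.length < W) &&
    (List.range (P.length + 1)).any fun n =>
      decide (P = encList (pathItems n P)) &&
        (pathItems n P).all (fun it => decide (1 ≤ it.length) && decide (it.length ≤ W)) &&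
        answerBit (kOf F x.length) (pathItems n P) keyL u

/-- **The decision function decides the keyed language.** [cite: Zhandry2012IBE, Thm. 3.1]
[cite: AaronsonAmbainis2014, Thm. 23 (proof, p. 14)] -/
theorem keyedLangDecide_eq_true_iff (w : List Bool) : keyedLangDecide F w = true ↔ w ∈ keyedLang F := by
  constructor
  · intro h
    simp only [keyedLangDecide, Bool.and_eq_true, decide_eq_true_eq, List.any_eq_true, List.mem_range,
      List.all_eq_true] at h
    obtain ⟨⟨⟨hw, hκ⟩, hu⟩, n, -, ⟨hP, hall⟩, hbit⟩ := h
    set a := (boolUnpair w).1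
    set b := (boolUnpair w).2
    set x := (boolUnpair a).1
    set c := (boolUnpair a).2
    set P := (boolUnpair c).1
    set t := (boolUnpair c).2
    set pad := (boolUnpair b).1
    set rest := (boolUnpair b).2
    set κ := keyPoly.eval (kOf F x.length + mOf F x.length)
    obtain ⟨ρ, hρ⟩ := exists_path_of_items (F := F) x (pathItems n P) fun it hit => hall it hit
    have hκlen : (rest.take κ).length = κ := by rw [List.length_take]; omega
    let key : Fin κ → Bool := fun i => (rest.take κ)[i.1]'(by rw [hκlen]; exact i.2)
    have hkeyL : List.ofFn key = rest.take κ := by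
      apply List.ext_getElem
      · rw [List.length_ofFn, hκlen]
      · intro i h1 h2
        rw [List.getElem_ofFn]
    refine ⟨x, ρ, t, pad, key, rest.drop κ, ?_, ?_⟩
    · rw [encPath_eq_encList, hρ, ← hP, hkeyL, List.take_append_drop]
      exact hw
    · rw [mem_oracleOf_hashedPt_iff x ρ key hu, hρ, hkeyL]
      exact hbit
  · rintro ⟨x, ρ, t, pad, key, u, rfl, hu⟩
    have hlen : (List.ofFn key).length = keyPoly.eval (kOf F x.length + mOf F x.length) := List.length_ofFn
    have hu' : u.length < oracleWidth F x := by
      obtain ⟨h, -⟩ := hu; exact mem_shortStrings.1 h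
    have htake : (List.ofFn key ++ u).take (keyPoly.eval (kOf F x.length + mOf F x.length)) = List.ofFn key :=
      List.take_left' hlen
    have hdrop : (List.ofFn key ++ u).drop (keyPoly.eval (kOf F x.length + mOf F x.length)) = u :=
      List.drop_left' hlen
    simp only [keyedLangDecide, boolUnpair_boolPair, Bool.and_eq_true, decide_eq_true_eq, List.any_eq_true,
      List.mem_range, List.all_eq_true, htake, hdrop, true_and]
    refine ⟨⟨by simp, hu'⟩, (ρ.map (pathItem F x)).length, ?_, ⟨?_, ?_⟩, ?_⟩
    · rw [encPath_eq_encList]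
      exact Nat.lt_succ_of_le (Com.length_le_length_encList _)
    · rw [encPath_eq_encList, pathItems_encList]
    · intro it hit
      rw [encPath_eq_encList, pathItems_encList] at hit
      obtain ⟨e, -, rfl⟩ := List.mem_map.1 hit
      exact length_pathItem F x e
    · rw [encPath_eq_encList, pathItems_encList]
      exact (mem_oracleOf_hashedPt_iff x ρ key hu').1 hu

/-! ### The decision function is computed on codes -/

/-- The re-assembled items of `CanonCode.itemsCanon id` are the nested-pair list of the decoded items. [folklore] -/
theorem itemsCanon_id_eq : ∀ (n : ℕ) (P : List Bool), CanonCode.itemsCanon id n P = encList (NegCNF.decList id n P)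
  | 0, _ => rfl
  | n + 1, P => by
    rw [CanonCode.itemsCanon, NegCNF.decList, encList_cons, CookLevin.boolPair_eq_dbl, itemsCanon_id_eq n]

/-- **`pathItems` is computed on codes**: `⟨1ⁿ, P⟩ ↦ encList (pathItems n P)` is `sndF ∘ canonListFn id`.
[cite: AroraBarak2009, §1.3 (bounded loops)] -/
theorem pathItemsC : CodeFP (pairE unE strE) (rawE strE) (fun q => pathItems q.1 q.2) := by
  refine of_fn (sndF ∘ CanonCode.canonListFn id)
    (comp_mem_FP sndF_mem_FP (CanonCode.canonListFn_mem_FP (PolyTimeComputable.id _) (a := 0) fun u => by simp))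
    fun q => ?_
  obtain ⟨n, P⟩ := q
  simp only [Function.comp_apply, pairE_apply, CanonCode.canonListFn_apply, boolUnpair_boolPair, sndF_boolPair,
    length_unE]
  rw [itemsCanon_id_eq]
  simp [rawE, strE, pathItems]

/-- The path field of `w` is short. [folklore] -/
theorem length_pathField_le (w : List Bool) :
    (boolUnpair (boolUnpair (boolUnpair w).1).2).1.length ≤ w.length := by
  have h1 := length_boolUnpair_parts_le w
  have h2 := length_boolUnpair_parts_le (boolUnpair w).1
  have h3 := length_boolUnpair_parts_le (boolUnpair (boolUnpair w).1).2
  omega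

variable {F} in
/-- **The decision function of the keyed language is computed on codes**, for a uniform `F`.
[cite: AroraBarak2009, §1.3] [cite: BennettBernsteinBrassardVazirani1997, Thm. 4.14] -/
theorem keyedLangDecideC (hF : F.IsUniform) : CodeFP strE bitE (keyedLangDecide F) := by
  have strE_inj : Function.Injective strE := fun _ _ h => h
  -- the fields of `w`
  have cFst : CodeFP strE strE (fun w => (boolUnpair w).1) := ⟨fstF, fstF_mem_FP, fun _ => rfl⟩
  have cSnd : CodeFP strE strE (fun w => (boolUnpair w).2) := ⟨sndF, sndF_mem_FP, fun _ => rfl⟩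
  have cX : CodeFP strE strE (fun w => (boolUnpair (boolUnpair w).1).1) := cFst.comp cFst
  have cC : CodeFP strE strE (fun w => (boolUnpair (boolUnpair w).1).2) := cSnd.comp cFst
  have cP : CodeFP strE strE (fun w => (boolUnpair (boolUnpair (boolUnpair w).1).2).1) := cFst.comp cC
  have cT : CodeFP strE strE (fun w => (boolUnpair (boolUnpair (boolUnpair w).1).2).2) := cSnd.comp cC
  have cPad : CodeFP strE strE (fun w => (boolUnpair (boolUnpair w).2).1) := cFst.comp cSnd
  have cRest : CodeFP strE strE (fun w => (boolUnpair (boolUnpair w).2).2) := cSnd.comp cSnd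
  -- check 1: re-encode and compare
  have cRe : CodeFP strE strE (fun w => boolPair (boolPair (boolUnpair (boolUnpair w).1).1
      (boolPair (boolUnpair (boolUnpair (boolUnpair w).1).2).1 (boolUnpair (boolUnpair (boolUnpair w).1).2).2))
      (boolPair (boolUnpair (boolUnpair w).2).1 (boolUnpair (boolUnpair w).2).2)) :=
    ((cX.pair (cP.pair cT)).pair (cPad.pair cRest)).recodeOut fun _ => rfl
  have c1 := (CodeFP.eq strE_inj).comp ((CodeFP.id strE).pair cRe)
  -- the size parameters (uniformity of `F`)
  have cN : CodeFP strE unE (fun w => (boolUnpair (boolUnpair w).1).1.length) := strLength.comp cX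
  have cW : CodeFP strE unE (fun w => mOf F (boolUnpair (boolUnpair w).1).1.length) := (codeFP_mOf_un F hF).comp cN
  have cK : CodeFP strE unE (fun w => kOf F (boolUnpair (boolUnpair w).1).1.length) := (codeFP_kOf_un F hF).comp cN
  have cκ : CodeFP strE unE (fun w => keyPoly.eval (kOf F (boolUnpair (boolUnpair w).1).1.length +
      mOf F (boolUnpair (boolUnpair w).1).1.length)) := (codeFP_keyWidth F hF).comp cN
  have cKeyL := strTake.comp (cκ.pair cRest)
  have cU := strDrop.comp (cκ.pair cRest)
  -- checks 2 and 3
  have c2 := unLeNat.comp (cκ.pair (strNatLength.comp cRest))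
  have c3 := natLt.comp ((strNatLength.comp cU).pair (natOfUn.comp cW))
  -- the item counts `0, …, |P|`, as unary numerals (budget `|w|`)
  have cNs : CodeFP strE (rawE unE) (fun w => List.range ((boolUnpair (boolUnpair (boolUnpair w).1).2).1.length + 1)) := by
    have h1 : CodeFP strE (rawE natE)
        (fun w => List.range ((boolUnpair (boolUnpair (boolUnpair w).1).2).1.length + 1)) :=
      urange.comp (unSucc.comp (strLength.comp cP))
    have h2 : CodeFP (pairE strE natE) unE (fun q => min q.2 q.1.length) :=
      unOfNatMin.comp ((strLength.comp (fst _ _)).pair (snd _ _))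
    refine ((CodeFP.map h2).comp ((CodeFP.id strE).pair h1)).congr fun w => ?_
    dsimp only [id]
    conv_rhs => rw [← List.map_id (List.range _)]
    refine List.map_congr_left fun n hn => ?_
    rw [List.mem_range] at hn
    have := length_pathField_le w
    rw [id, min_eq_left (by omega)]
  -- the predicate on `(w, n)`
  have dW : CodeFP (pairE strE unE) strE (fun q => q.1) := fst _ _
  have dN : CodeFP (pairE strE unE) unE (fun q => q.2) := snd _ _
  have dItems : CodeFP (pairE strE unE) (rawE strE)
      (fun q => pathItems q.2 (boolUnpair (boolUnpair (boolUnpair q.1).1).2).1) := pathItemsC.comp (dN.pair (cP.comp dW))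
  have dEnc : CodeFP (pairE strE unE) strE
      (fun q => encList (pathItems q.2 (boolUnpair (boolUnpair (boolUnpair q.1).1).2).1)) :=
    dItems.recodeOut fun q => by simp [rawE, strE]
  have d1 := (CodeFP.eq strE_inj).comp ((cP.comp dW).pair dEnc)
  -- every item has length in `[1, W]`
  have eIt : CodeFP (pairE (pairE strE unE) strE) strE (fun r => r.2) := snd _ _
  have eLen : CodeFP (pairE (pairE strE unE) strE) natE (fun r => r.2.length) := strNatLength.comp eIt
  have eW := natOfUn.comp (cW.comp (fst (pairE strE unE) strE).fst')
  have eP : CodeFP (pairE (pairE strE unE) strE) bitE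
      (fun r => decide (1 ≤ r.2.length) && decide (r.2.length ≤ mOf F (boolUnpair (boolUnpair r.1.1).1).1.length)) :=
    (natLe.comp ((const _ 1).pair eLen)).and (natLe.comp (eLen.pair eW))
  have d2 := (CodeFP.all eP).comp ((CodeFP.id (pairE strE unE)).pair dItems)
  -- the answer bit
  have eU := cU.comp (fst (pairE strE unE) strE).fst'
  have eQ : CodeFP (pairE (pairE strE unE) strE) bitE
      (fun r => decide (r.2.drop 1 = ((boolUnpair (boolUnpair r.1.1).2).2).drop
        (keyPoly.eval (kOf F (boolUnpair (boolUnpair r.1.1).1).1.length + mOf F (boolUnpair (boolUnpair r.1.1).1).1.length)))) :=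
    (CodeFP.eq strE_inj).comp ((strDrop.comp ((const _ 1).pair eIt)).pair eU)
  have dHits := (CodeFP.filter eQ).comp ((CodeFP.id (pairE strE unE)).pair dItems)
  have dEmpty := (rawIsEmpty strE).comp dHits
  have dHead := strGetD.comp ((const _ 0).pair ((rawHeadD strE (d := []) rfl).comp dHits))
  have dHashArg : CodeFP (pairE strE unE) strE
      (fun q => boolPair (boolPair (List.replicate (kOf F (boolUnpair (boolUnpair q.1).1).1.length) true)
        (((boolUnpair (boolUnpair q.1).2).2).take (keyPoly.eval (kOf F (boolUnpair (boolUnpair q.1).1).1.length +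
          mOf F (boolUnpair (boolUnpair q.1).1).1.length))))
        (((boolUnpair (boolUnpair q.1).2).2).drop (keyPoly.eval (kOf F (boolUnpair (boolUnpair q.1).1).1.length +
          mOf F (boolUnpair (boolUnpair q.1).1).1.length)))) :=
    (((cK.comp dW).pair (cKeyL.comp dW)).pair (cU.comp dW)).recodeOut fun q => by
      simp only [pairE_apply, unE_eq_ones, ones]; rfl
  have dHash := hashLangDecideC.comp dHashArg
  have dAns : CodeFP (pairE strE unE) bitE
      (fun q => answerBit (kOf F (boolUnpair (boolUnpair q.1).1).1.length)
        (pathItems q.2 (boolUnpair (boolUnpair (boolUnpair q.1).1).2).1)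
        (((boolUnpair (boolUnpair q.1).2).2).take (keyPoly.eval (kOf F (boolUnpair (boolUnpair q.1).1).1.length +
          mOf F (boolUnpair (boolUnpair q.1).1).1.length)))
        (((boolUnpair (boolUnpair q.1).2).2).drop (keyPoly.eval (kOf F (boolUnpair (boolUnpair q.1).1).1.length +
          mOf F (boolUnpair (boolUnpair q.1).1).1.length)))) :=
    (dEmpty.ite dHash dHead).congr fun _ => rfl
  have dPred := (d1.and d2).and dAns
  have c4 := (CodeFP.any dPred).comp ((CodeFP.id strE).pair cNs)
  exact (((c1.and c2).and c3).and c4).congr fun _ => rfl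

variable {F} in
/-- **The keyed language of the node tests is in `P`**, for a uniform `F`. [cite: AroraBarak2009, §1.3]
[cite: Zhandry2012IBE, Thm. 3.1] -/
theorem keyedLang_mem_P (hF : F.IsUniform) : keyedLang F ∈ Classes.P := by
  obtain ⟨G, hG, hGw⟩ := keyedLangDecideC hF
  refine mem_P_of_mem_FP hG _ fun w => ⟨fun hw => ?_, fun hw => ?_⟩
  · rw [show G w = bitE (keyedLangDecide F w) from hGw w, (keyedLangDecide_eq_true_iff F w).2 hw]; rfl
  · rw [show G w = bitE (keyedLangDecide F w) from hGw w]
    have : keyedLangDecide F w = false := by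
      cases h : keyedLangDecide F w
      · rfl
      · exact absurd ((keyedLangDecide_eq_true_iff F w).1 h) hw
    rw [this]; rfl

end SimTreePB

end Summit.QuantumAdvantage.QuantumAdvantage.Cruxes.TransferPB.Birth

end
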